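import Summits.ValiantsHypothesis.ValiantsHypothesis.Theorems.ValuativeGCTValuativeFlipTwistPositivityTransfer
import Summits.ValiantsHypothesis.ValiantsHypothesis.Theorems.ValuativeGCTValuativeFlipInnerMonotone
import Summits.ValiantsHypothesis.ValiantsHypothesis.Theorems.ValuativeGCTValuativeFlipRayStability
import Literature.LinearAlgebra.Matrix.PermanentSubperm
import Literature.Computability.AlgebraicComplexity.BIPPaddingDegenerations
import HarnessLib

/-!
# Diagonal inheritance: the per side of the flip is monotone along `(n, m) ↦ (n + j, m + j)` at EVERY step
# (crux `ValuativeGCT.ValuativeFlip`, stmt-ValiantsHypothesis-12624; wall-breaker k12, axis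
# "representation-stability transfer between `m` and `m + 1`"; helper file `--supports`)

Letters: inner size `n ≤ m` (level `m`), degree `δ`, shape `λ ⊢ m·δ` with at most `m²` parts,
`P(n, m, λ) := mult_{λ*} ℂ[Δ_m(X₀₀^{m-n} per_n)]` (`orbitMultiplicity` of `paddedPerFormLex ℂ n m`), and
`λ♯(m+j) = rowLift λ j` (`j·δ` boxes added to the first row).

The size transfers of the per side that the tree had before this file: `n ↦ n'` at fixed level
(`orbitMultiplicity_paddedPer_mono_inner`, a degeneration), and `(n, n) ↦ (n, n + j)` from the UNPADDED
anchor at every padding (`perAnchorInheritance_every`, twist positivity).  The docstring of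
`…InnerMonotone` records the DIAGONAL move `(n, m) ↦ (n+1, m+1)` ("the padding lift") as open for orbit
closures.  It is settled here, at every step and for every start `(n, m)`:

* `exists_linSubst_paddedPerFormLex_eq_paddedForm_diag`: for EVERY matrix `A ∈ Mat_{m²}` the padded point
  `X_top^j · ι(A · X₀₀^{m-n} per_n)` (`paddedForm m j (A · pp)`) is an `End`-orbit point of
  `X₀₀^{m-n} per_{n+j}` at level `m + j`: send the padding variable to `ι(A·X₀₀)`, the first `j` diagonal
  block variables to `X_top`, the rest of their rows to `0`, and the last `n × n` block to `ι(A · x)`; the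
  permanent of the resulting block-triangular matrix is `X_top^j · per_n(ι(A·x))`
  (`Matrix.permanent_fromBlocks_zero₂₁`).  No normalisation of `A` is needed (contrast
  `exists_linSubst_paddedPerFormLex_eq_paddedForm_of_col`, the fixed-`n` padding move, which needs
  `A · X₀₀ = X_top`): the extra inner row supplies the fresh padding letter.
* `orbitMultiplicity_paddedPer_le_diag`: **`P(n, m, λ) ≤ P(n + j, m + j, λ♯(m+j))` for all `n ≤ m`, `δ`,
  `λ`, `j`** — the every-`j` transfer along closure points (`orbitMultiplicity_le_rowLift_of_closurePoints`,
  twist positivity) applied to these points.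
* `orbitMultiplicity_paddedPer_mono_order`: with inner monotonicity, `P` is monotone for the partial
  order `(n, m) ≼ (n', m')` iff `m ≤ m'` and `m' - n' ≤ m - n` (more level, no more padding):
  `P(n, m, λ) ≤ P(n', m + j, λ♯)` for `n + j ≤ n' ≤ m + j`.
* `orbitMultiplicity_paddedPer_klRay_le_diag`: the diagonal dominates the Kadish–Landsberg ray termwise,
  `P(n, m + j, λ♯) ≤ P(n + j, m + j, λ♯)`.
* `orbitMultiplicity_paddedPer_diag_mono`: the diagonal sequence `j ↦ P(n + j, m + j, λ♯(m+j))` is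
  non-decreasing at every step.

What this does NOT give (AXIS.md of this seat): a transfer that increases the padding `m - n` from a
padded start (same-letter step monotonicity is false for general padded forms,
`padding_step_monotonicity_fails`), nor any movement of the flip frontier — per-side lower bounds
still flow only toward the diagonal (here: parallel to it), and the determinant side is co-monotone
along the same move (`det_everyStepMonotone` at inner size `m`).

Sources: BLMW, SIAM J. Comput. 40 (2011) §6.4 Problem 6.10; Bürgisser–Ikenmeyer–Panova, J. AMS 32 (2019)
§1(a), Lemma 5.2, Thm. 5.4; Ikenmeyer–Panova 2017 Prop. 2.6(b); Mulmuley–Sohoni 2001 §4 (End-orbits lie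
in the closure); H. Minc, *Permanents* (1978) §1 (block-triangular permanents).  No new definitions.
-/

set_option linter.dupNamespace false

namespace Summit.ValiantsHypothesis.ValiantsHypothesis.Theorems.ValuativeFlip

open scoped BigOperators Matrix
open MvPolynomial
open Literature.NumberTheory.DiophantineGeometry
open Literature.Computability.AlgebraicComplexity
open Literature.Computability.Complexity

noncomputable section

/-! ## The padded points along the diagonal are `End`-orbit points -/

/-- The padded permanent along an arbitrary enumeration `e : ι ≃ block` of its block:
`X₀₀^{m-n} · per(X_{e a, e b})`. [Mulmuley–Sohoni 2001 §4; folklore] -/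
theorem dg_paddedPerFormLex_eq {ι : Type*} [Fintype ι] [DecidableEq ι] (n m : ℕ) [NeZero m]
    (e : ι ≃ BlockIdx n m) :
    paddedPerFormLex ℂ n m = (X (toLex ((0 : Fin m), (0 : Fin m))) : MvPolynomial (MatIdx m) ℂ) ^ (m - n) *
      rename (fun ab : ι × ι => (toLex (((e ab.1 : BlockIdx n m) : Fin m), ((e ab.2 : BlockIdx n m) : Fin m)) : MatIdx m))
        (perPoly ι ℂ) := by
  rw [paddedPerFormLex_eq, ← rename_perPoly_equiv (k := ℂ) e, rename_rename]
  rfl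

/-- **The diagonal padded points are `End`-orbit points.**  For `n ≤ m`, every `j` and EVERY matrix
`A ∈ Mat_{m²}` there is `M ∈ Mat_{(m+j)²}` with
`M · (X₀₀^{m-n} per_{n+j}) = X_top^j · (A · X₀₀^{m-n} per_n)|segment` (`paddedForm m j (A · pp_{n,m})`):
enumerate the `(n+j)`-block as `Fin j ⊕ Fin n`, send the padding variable to the segment copy of
`A · X₀₀`, the diagonal variables of the `Fin j`-part to `X_top` and the rest of the `Fin j`-rows and
-columns to `0`, and the `Fin n × Fin n` variables to the segment copies of the columns of `A`; the
substituted block matrix is block-diagonal `diag(X_top,…,X_top) ⊕ (A·x)|segment`, whose permanent is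
`X_top^j · per_n((A·x)|segment)` (`Matrix.permanent_fromBlocks_zero₂₁`).  No normalisation of `A` is
required. [Mulmuley–Sohoni 2001 §4; Bürgisser–Ikenmeyer–Panova 2019 §1(a); Minc 1978 §1] -/
theorem exists_linSubst_paddedPerFormLex_eq_paddedForm_diag (n m j : ℕ) [NeZero m] [NeZero (m + j)]
    (hnm : n ≤ m) (A : Matrix (MatIdx m) (MatIdx m) ℂ) :
    ∃ M : Matrix (MatIdx (m + j)) (MatIdx (m + j)) ℂ,
      linSubst (MatIdx (m + j)) ℂ M (paddedPerFormLex ℂ (n + j) (m + j)) =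
        paddedForm m j (linSubst (MatIdx m) ℂ A (paddedPerFormLex ℂ n m)) := by
  classical
  -- enumerations of the two blocks
  have hcard : Fintype.card (Fin j ⊕ Fin n) = Fintype.card (BlockIdx (n + j) (m + j)) := by
    rw [Fintype.card_sum, Fintype.card_fin, Fintype.card_fin, card_blockIdx (by omega : n + j ≤ m + j)]
    omega
  let e : Fin j ⊕ Fin n ≃ BlockIdx (n + j) (m + j) := Fintype.equivOfCardEq hcard
  let e₀ : Fin n ≃ BlockIdx n m := (Fintype.equivFinOfCardEq (card_blockIdx hnm)).symm
  let E : (Fin j ⊕ Fin n) × (Fin j ⊕ Fin n) → MatIdx (m + j) := fun ab =>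
    toLex (((e ab.1 : BlockIdx (n + j) (m + j)) : Fin (m + j)), ((e ab.2 : BlockIdx (n + j) (m + j)) : Fin (m + j)))
  let E₀ : Fin n × Fin n → MatIdx m := fun ab =>
    toLex (((e₀ ab.1 : BlockIdx n m) : Fin m), ((e₀ ab.2 : BlockIdx n m) : Fin m))
  have hinj : Function.Injective E := by
    intro ab ab' h
    have h1 := congrArg (fun x : MatIdx (m + j) => (ofLex x).1) h
    have h2 := congrArg (fun x : MatIdx (m + j) => (ofLex x).2) h
    simp only [E, ofLex_toLex] at h1 h2
    exact Prod.ext (e.injective (Subtype.ext h1)) (e.injective (Subtype.ext h2))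
  let seg : MatIdx m → MatIdx (m + j) := segEmb (Nat.le_add_right m j)
  -- the coefficient column of the image of each block variable
  let col : (Fin j ⊕ Fin n) × (Fin j ⊕ Fin n) → MatIdx (m + j) → ℂ := fun ab s =>
    Sum.elim
      (fun t : Fin j => Sum.elim (fun t' : Fin j => if t = t' ∧ s = topMatIdx (m + j) then (1 : ℂ) else 0)
        (fun _ : Fin n => (0 : ℂ)) ab.2)
      (fun a : Fin n => Sum.elim (fun _ : Fin j => (0 : ℂ))
        (fun b : Fin n => ∑ r : MatIdx m, if seg r = s then A r (E₀ (a, b)) else 0) ab.2)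
      ab.1
  -- the substitution matrix, column by column (block variables first, then the padding variable)
  let M : Matrix (MatIdx (m + j)) (MatIdx (m + j)) ℂ := fun s i =>
    if h : ∃ ab, E ab = i then col (Classical.choose h) s
    else if i = toLex ((0 : Fin (m + j)), (0 : Fin (m + j))) then
      ∑ r : MatIdx m, (if seg r = s then A r (toLex ((0 : Fin m), (0 : Fin m))) else 0)
    else 0
  -- images of the block variables
  have hM_E : ∀ ab, linSubst (MatIdx (m + j)) ℂ M (X (E ab)) =
      ∑ s : MatIdx (m + j), col ab s • (X s : MvPolynomial (MatIdx (m + j)) ℂ) := by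
    intro ab
    have hex : ∃ ab', E ab' = E ab := ⟨ab, rfl⟩
    have hch : Classical.choose hex = ab := hinj (Classical.choose_spec hex)
    rw [linSubst_X]
    refine Finset.sum_congr rfl fun s _ => ?_
    simp only [M, dif_pos hex, hch]
  have hM_ll : ∀ t t' : Fin j, linSubst (MatIdx (m + j)) ℂ M (X (E (Sum.inl t, Sum.inl t'))) =
      if t = t' then (X (topMatIdx (m + j)) : MvPolynomial (MatIdx (m + j)) ℂ) else 0 := by
    intro t t'
    rw [hM_E]
    simp only [col, Sum.elim_inl]
    by_cases htt : t = t'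
    · simp only [htt, true_and, ite_smul, one_smul, zero_smul, if_true]
      rw [Finset.sum_ite_eq' Finset.univ (topMatIdx (m + j)), if_pos (Finset.mem_univ _)]
    · simp [htt]
  have hM_lr : ∀ (t : Fin j) (b : Fin n), linSubst (MatIdx (m + j)) ℂ M (X (E (Sum.inl t, Sum.inr b))) = 0 := by
    intro t b
    rw [hM_E]
    simp [col]
  have hM_rl : ∀ (a : Fin n) (t : Fin j), linSubst (MatIdx (m + j)) ℂ M (X (E (Sum.inr a, Sum.inl t))) = 0 := by
    intro a t
    rw [hM_E]
    simp [col]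
  have hM_rr : ∀ a b : Fin n, linSubst (MatIdx (m + j)) ℂ M (X (E (Sum.inr a, Sum.inr b))) =
      rename seg (linSubst (MatIdx m) ℂ A (X (E₀ (a, b)))) := by
    intro a b
    rw [hM_E, linSubst_X, map_sum]
    simp only [col, Sum.elim_inr, map_smul, rename_X, Finset.sum_smul, ite_smul, zero_smul]
    rw [Finset.sum_comm]
    refine Finset.sum_congr rfl fun r _ => ?_
    rw [Finset.sum_ite_eq Finset.univ (seg r), if_pos (Finset.mem_univ _)]
  -- image of the padding variable (needed only when `n < m`)
  have hM_pad : n < m → linSubst (MatIdx (m + j)) ℂ M (X (toLex ((0 : Fin (m + j)), (0 : Fin (m + j))))) =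
      rename seg (linSubst (MatIdx m) ℂ A (X (toLex ((0 : Fin m), (0 : Fin m))))) := by
    intro hlt
    have hnot : ¬ ∃ ab, E ab = toLex ((0 : Fin (m + j)), (0 : Fin (m + j))) := by
      rintro ⟨ab, hab⟩
      have h1 := congrArg (fun x : MatIdx (m + j) => (((ofLex x).1 : Fin (m + j)) : ℕ)) hab
      simp only [E, ofLex_toLex, Fin.val_zero] at h1
      have h2 := (e ab.1).2
      omega
    rw [linSubst_X, linSubst_X, map_sum]
    simp only [M, dif_neg hnot, if_true, map_smul, rename_X, Finset.sum_smul, ite_smul, zero_smul]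
    rw [Finset.sum_comm]
    refine Finset.sum_congr rfl fun r _ => ?_
    rw [Finset.sum_ite_eq Finset.univ (seg r), if_pos (Finset.mem_univ _)]
  -- the substituted block matrix is block-diagonal, and its permanent factors
  have hmat : (Matrix.of fun a b : Fin j ⊕ Fin n => linSubst (MatIdx (m + j)) ℂ M (X (E (a, b)))) =
      Matrix.fromBlocks (Matrix.diagonal fun _ : Fin j => (X (topMatIdx (m + j)) : MvPolynomial (MatIdx (m + j)) ℂ))
        0 0 (Matrix.of fun a b : Fin n => rename seg (linSubst (MatIdx m) ℂ A (X (E₀ (a, b))))) := by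
    ext a b
    rcases a with t | a <;> rcases b with t' | b
    · rw [Matrix.of_apply, Matrix.fromBlocks_apply₁₁, hM_ll, Matrix.diagonal_apply]
    · rw [Matrix.of_apply, Matrix.fromBlocks_apply₁₂, hM_lr, Matrix.zero_apply]
    · rw [Matrix.of_apply, Matrix.fromBlocks_apply₂₁, hM_rl, Matrix.zero_apply]
    · rw [Matrix.of_apply, Matrix.fromBlocks_apply₂₂, hM_rr, Matrix.of_apply]
  have hper : (Matrix.of fun a b : Fin j ⊕ Fin n => linSubst (MatIdx (m + j)) ℂ M (X (E (a, b)))).permanent =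
      (X (topMatIdx (m + j)) : MvPolynomial (MatIdx (m + j)) ℂ) ^ j *
        (Matrix.of fun a b : Fin n => rename seg (linSubst (MatIdx m) ℂ A (X (E₀ (a, b))))).permanent := by
    rw [hmat, Matrix.permanent_fromBlocks_zero₂₁, Matrix.permanent_diagonal, Finset.prod_const,
      Finset.card_univ, Fintype.card_fin]
  -- both sides, unfolded
  have hsub : m + j - (n + j) = m - n := Nat.add_sub_add_right m j n
  have hL : linSubst (MatIdx (m + j)) ℂ M (paddedPerFormLex ℂ (n + j) (m + j)) =
      (linSubst (MatIdx (m + j)) ℂ M (X (toLex ((0 : Fin (m + j)), (0 : Fin (m + j)))))) ^ (m + j - (n + j)) *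
        ((X (topMatIdx (m + j)) : MvPolynomial (MatIdx (m + j)) ℂ) ^ j *
          (Matrix.of fun a b : Fin n => rename seg (linSubst (MatIdx m) ℂ A (X (E₀ (a, b))))).permanent) := by
    rw [dg_paddedPerFormLex_eq (n + j) (m + j) e, map_mul, map_pow, linSubst_rename_eq_aeval,
      aeval_perPoly, hper]
  have hR : paddedForm m j (linSubst (MatIdx m) ℂ A (paddedPerFormLex ℂ n m)) =
      (X (topMatIdx (m + j)) : MvPolynomial (MatIdx (m + j)) ℂ) ^ j *
        ((rename seg (linSubst (MatIdx m) ℂ A (X (toLex ((0 : Fin m), (0 : Fin m)))))) ^ (m - n) *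
          (Matrix.of fun a b : Fin n => rename seg (linSubst (MatIdx m) ℂ A (X (E₀ (a, b))))).permanent) := by
    rw [dg_paddedPerFormLex_eq n m e₀, map_mul, map_pow, paddedForm, map_mul, map_pow,
      linSubst_rename_eq_aeval, rename_aeval_eq_aeval, aeval_perPoly]
  refine ⟨M, ?_⟩
  rw [hL, hR, hsub]
  rcases Nat.eq_zero_or_pos (m - n) with h0 | hpos
  · rw [h0, pow_zero, pow_zero, one_mul, one_mul]
  · rw [hM_pad (by omega)]
    ring

/-- **Closure form.**  For `n ≤ m`, every `j` and every `A ∈ Mat_{m²}`: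
`X_top^j · ι(A · X₀₀^{m-n} per_n) ∈ Δ_{m+j}(X₀₀^{m-n} per_{n+j})` (`End`-orbit points lie in the orbit
closure, `endOrbit_subset_orbitClosure_holds`). [Mulmuley–Sohoni 2001 §4] -/
theorem paddedForm_linSubst_paddedPerFormLex_mem_orbitClosure_diag (n m j : ℕ) [NeZero m] [NeZero (m + j)]
    (hnm : n ≤ m) (A : Matrix (MatIdx m) (MatIdx m) ℂ) :
    paddedForm m j (linSubst (MatIdx m) ℂ A (paddedPerFormLex ℂ n m)) ∈
      orbitClosure (paddedPerFormLex ℂ (n + j) (m + j)) := by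
  obtain ⟨M, hM⟩ := exists_linSubst_paddedPerFormLex_eq_paddedForm_diag n m j hnm A
  rw [← hM]
  exact endOrbit_subset_orbitClosure_holds _ ⟨M, rfl⟩

/-! ## Diagonal inheritance of multiplicities -/

/-- **Diagonal inheritance (every step, every start).**  For `n ≤ m`, every `δ`, every `λ ⊢ m·δ`
with at most `m²` parts and EVERY `j`:
`mult_{λ*} ℂ[Δ_m(X₀₀^{m-n} per_n)] ≤ mult_{(λ♯(m+j))*} ℂ[Δ_{m+j}(X₀₀^{m-n} per_{n+j})]` — the per side of
the flip body is non-decreasing along the diagonal move `(n, m) ↦ (n + j, m + j)` (padding `m - n` fixed,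
level and inner size up together).  The every-`j` transfer along closure points
(`orbitMultiplicity_le_rowLift_of_closurePoints`, twist positivity) at the diagonal padded points
(`paddedForm_linSubst_paddedPerFormLex_mem_orbitClosure_diag`).  At `m = n` this is dominated by
`perAnchorInheritance_every` (whose target `X₀₀^j per_n` degenerates from `per_{n+j}`); for `n < m` it is
new: no composite of inner monotonicity and anchor inheritance reaches `(n+j, m+j)` from `(n, m)`.
[BLMW 2011 §6.4 Problem 6.10; Bürgisser–Ikenmeyer–Panova 2019 §5; this crux] -/
theorem orbitMultiplicity_paddedPer_le_diag {n m : ℕ} [NeZero m] (hnm : n ≤ m) {δ : ℕ}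
    (lam : Nat.Partition (m * δ)) (hlam : lam.parts.card ≤ m * m) (j : ℕ) [NeZero (m + j)] :
    orbitMultiplicity ℂ (paddedPerFormLex ℂ n m) m (partitionWeightLex m lam) ≤
      orbitMultiplicity ℂ (paddedPerFormLex ℂ (n + j) (m + j)) (m + j)
        (partitionWeightLex (m + j) (rowLift lam j)) :=
  orbitMultiplicity_le_rowLift_of_closurePoints (paddedPerFormLex ℂ n m)
    (paddedPerFormLex_isHomogeneous ℂ hnm) lam hlam j (paddedPerFormLex ℂ (n + j) (m + j))
    (paddedPerFormLex_isHomogeneous ℂ (by omega)) (paddedPerFormLex_ne_zero' _ _)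
    fun A => paddedForm_linSubst_paddedPerFormLex_mem_orbitClosure_diag n m j hnm A

/-- **Monotonicity for the order `(n, m) ≼ (n', m')` ("more level, no more padding").**  For
`n ≤ m` and `n + j ≤ n' ≤ m + j`:
`mult_{λ*} ℂ[Δ_m(X₀₀^{m-n} per_n)] ≤ mult_{(λ♯(m+j))*} ℂ[Δ_{m+j}(X₀₀^{m+j-n'} per_{n'})]` — diagonal
inheritance followed by inner monotonicity (`orbitMultiplicity_paddedPer_mono_inner`).  So the per side
of the flip body, as a function on the window lattice `{(n, m) : n ≤ m}`, is non-decreasing whenever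
the level does not drop and the padding `m - n` does not grow. [this crux] -/
theorem orbitMultiplicity_paddedPer_mono_order {n m n' : ℕ} [NeZero m] (hnm : n ≤ m) {δ : ℕ}
    (lam : Nat.Partition (m * δ)) (hlam : lam.parts.card ≤ m * m) (j : ℕ) [NeZero (m + j)]
    (hn' : n + j ≤ n') (hn'm : n' ≤ m + j) :
    orbitMultiplicity ℂ (paddedPerFormLex ℂ n m) m (partitionWeightLex m lam) ≤
      orbitMultiplicity ℂ (paddedPerFormLex ℂ n' (m + j)) (m + j)
        (partitionWeightLex (m + j) (rowLift lam j)) :=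
  (orbitMultiplicity_paddedPer_le_diag hnm lam hlam j).trans
    (orbitMultiplicity_paddedPer_mono_inner hn' hn'm _)

/-- **The diagonal dominates the Kadish–Landsberg ray termwise**: at the common level `m + j` and
shape `λ♯(m+j)`, `mult ℂ[Δ_{m+j}(X₀₀^{m+j-n} per_n)] ≤ mult ℂ[Δ_{m+j}(X₀₀^{m-n} per_{n+j})]` — the ray
point `(n, m + j)` lies below the diagonal point `(n + j, m + j)` in the inner order (a degeneration,
`orbitMultiplicity_paddedPer_mono_inner`).  Together with `orbitMultiplicity_paddedPer_le_diag` both the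
ray `j ↦ P(n, m+j, λ♯)` (eventually, `eventualPaddingTransfer`; from the anchor at every `j`,
`perAnchorInheritance_every`) and the diagonal `j ↦ P(n+j, m+j, λ♯)` (at every step, below) inherit the
base value `P(n, m, λ)`, and the diagonal is the larger of the two. [this crux] -/
theorem orbitMultiplicity_paddedPer_klRay_le_diag {n m : ℕ} (hnm : n ≤ m) (j : ℕ) [NeZero (m + j)]
    (χ : Weight (MatIdx (m + j))) :
    orbitMultiplicity ℂ (paddedPerFormLex ℂ n (m + j)) (m + j) χ ≤
      orbitMultiplicity ℂ (paddedPerFormLex ℂ (n + j) (m + j)) (m + j) χ :=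
  orbitMultiplicity_paddedPer_mono_inner (Nat.le_add_right n j) (by omega) χ

/-- Transport of `mult_{λ*} ℂ[Δ_m(X₀₀^{m-n} per_n)]` along equalities of inner size, level and parts
(both sizes enter the TYPE of `paddedPerFormLex ℂ n m`). [folklore] -/
theorem dg_orbitMultiplicity_paddedPer_congr {n₁ n₂ m₁ m₂ : ℕ} (hn : n₁ = n₂) (hm : m₁ = m₂)
    [NeZero m₁] [NeZero m₂] {D₁ D₂ : ℕ} (lam₁ : Nat.Partition D₁) (lam₂ : Nat.Partition D₂)
    (hp : lam₁.parts = lam₂.parts) :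
    orbitMultiplicity ℂ (paddedPerFormLex ℂ n₁ m₁) m₁ (partitionWeightLex m₁ lam₁) =
      orbitMultiplicity ℂ (paddedPerFormLex ℂ n₂ m₂) m₂ (partitionWeightLex m₂ lam₂) := by
  subst hn
  subst hm
  have hD : D₁ = D₂ := by rw [← lam₁.parts_sum, ← lam₂.parts_sum, hp]
  subst hD
  obtain rfl : lam₁ = lam₂ := Nat.Partition.ext hp
  rfl

/-- **The diagonal sequence is non-decreasing at every step.**  For `n ≤ m`, `λ ⊢ m·δ` with at most
`m²` parts and `j₁ ≤ j₂`:
`mult_{(λ♯(m+j₁))*} ℂ[Δ_{m+j₁}(X₀₀^{m-n} per_{n+j₁})] ≤ mult_{(λ♯(m+j₂))*} ℂ[Δ_{m+j₂}(X₀₀^{m-n} per_{n+j₂})]`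
(diagonal inheritance from the start `(n + j₁, m + j₁)`, whose row lifts are those of `λ`,
`parts_rowLift_rowLift`).  Contrast the Kadish–Landsberg ray at fixed `n`, which is monotone only
eventually (`eventualPaddingTransfer`) and can drop at a single step for general padded forms
(`padding_step_monotonicity_fails`). [this crux] -/
theorem orbitMultiplicity_paddedPer_diag_mono {n m : ℕ} [NeZero m] (hnm : n ≤ m) {δ : ℕ}
    (lam : Nat.Partition (m * δ)) (hlam : lam.parts.card ≤ m * m) {j₁ j₂ : ℕ} (hj : j₁ ≤ j₂)
    [NeZero (m + j₁)] [NeZero (m + j₂)] :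
    orbitMultiplicity ℂ (paddedPerFormLex ℂ (n + j₁) (m + j₁)) (m + j₁)
        (partitionWeightLex (m + j₁) (rowLift lam j₁)) ≤
      orbitMultiplicity ℂ (paddedPerFormLex ℂ (n + j₂) (m + j₂)) (m + j₂)
        (partitionWeightLex (m + j₂) (rowLift lam j₂)) := by
  obtain ⟨d, rfl⟩ := Nat.exists_eq_add_of_le hj
  haveI : NeZero (m + j₁ + d) := ⟨by have := NeZero.ne (m + (j₁ + d)); omega⟩
  have hlam₁ : (rowLift lam j₁).parts.card ≤ (m + j₁) * (m + j₁) := card_parts_rowLift_le_sq lam hlam j₁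
  have h := orbitMultiplicity_paddedPer_le_diag (n := n + j₁) (m := m + j₁) (by omega) (rowLift lam j₁) hlam₁ d
  rw [dg_orbitMultiplicity_paddedPer_congr (n₁ := n + j₁ + d) (n₂ := n + (j₁ + d)) (m₁ := m + j₁ + d)
    (m₂ := m + (j₁ + d)) (by omega) (by omega) (rowLift (rowLift lam j₁) d) (rowLift lam (j₁ + d))
    (parts_rowLift_rowLift lam j₁ d)] at h
  exact h

end

end Summit.ValiantsHypothesis.ValiantsHypothesis.Theorems.ValuativeFlip
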